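import Summits.Ventures.PackingBounds.ThreePointCert.T16d11Proof
import Summits.Ventures.PackingBounds.SphericalCodes.TammesReading
import Summits.Ventures.PackingBounds.Configurations.TammesConfigsA

/-!
# Tammes problem, `N = 16`: `θ(16) < arccos(374/625) = 53.244…°` (kernel-checked three-point bound)

Framing: lottery ticket; floor = certified bounds/negative ranges. Venture `PackingBounds`
(cell `pub-packcert`), spherical-codes family, table B2b (Tammes) row `N = 16`.

The kernel-checked Bachoc–Vallentin three-point certificate
`ThreePointCert.T16d11.tammes16_card_le_15_sdp` (`n = 3`, `s = 374/625`, degree 11, Bachoc–Vallentin's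
multiplier set, Chebyshev kernels on `S²`; exact bound value `15.959363 < 16`) says: every finite set of
unit vectors of `ℝ³` with pairwise inner products `≤ 374/625` has at most `15` elements. In Tammes form:
among any `16` or more points of `S²` two distinct ones make an angle `< arccos(374/625) = 53.244…°`,
so `θ(16) < arccos(374/625)`. Print record: Bachoc–Vallentin, ISIT 2007, Table 5.3 (degree 10):
`θ(16) ≤ 53.27°`; classical Fejes Tóth bound `54.85°`; best configuration known `52.2444…°`
(`Config.TammesConfigsA`). A certified bound, not a configuration and not an optimality claim.

## References
* C. Bachoc, F. Vallentin, J. Amer. Math. Soc. 21 (2008), Theorem 4.2. [`BachocVallentin2007`]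
* C. Bachoc, F. Vallentin, Semidefinite programming, multivariate orthogonal polynomials, and codes in
  spherical caps, Proc. ISIT 2007, Table 5.3.
-/

noncomputable section

open Finset
open scoped RealInnerProductSpace

namespace Summit.Ventures.PackingBounds.SphericalCodes

/-- **Tammes `N = 16`, inner products**: among any `16` or more unit vectors of `ℝ³`, two distinct ones
have inner product `> 374/625`. -/
theorem tammes16_exists_inner_gt (C : Finset (EuclideanSpace ℝ (Fin 3)))
    (h1 : ∀ x ∈ C, ‖x‖ = 1) (hC : 15 < C.card) :
    ∃ x ∈ C, ∃ y ∈ C, x ≠ y ∧ (374 / 625 : ℝ) < inner ℝ x y :=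
  exists_inner_gt_of_codeBound ThreePointCert.T16d11.tammes16_card_le_15_sdp C h1 hC

/-- **Tammes `N = 16`, angles**: among any `16` or more unit vectors of `ℝ³`, two distinct ones make an
(unoriented) angle `< arccos(374/625)` (`= 53.244…°`; printed SDP bound `53.27°`, BV 2007 T5.3). -/
theorem tammes16_exists_angle_lt_arccos (C : Finset (EuclideanSpace ℝ (Fin 3)))
    (h1 : ∀ x ∈ C, ‖x‖ = 1) (hC : 15 < C.card) :
    ∃ x ∈ C, ∃ y ∈ C, x ≠ y ∧ InnerProductGeometry.angle x y < Real.arccos (374 / 625) :=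
  exists_angle_lt_arccos_of_codeBound ThreePointCert.T16d11.tammes16_card_le_15_sdp
    (by norm_num) C h1 hC

/-- **`θ(16) < arccos(374/625)`**: any common lower bound `θ` for the pairwise angles of `16` or more
unit vectors of `ℝ³` satisfies `θ < arccos(374/625)`. -/
theorem tammes16_minAngle_lt_arccos (C : Finset (EuclideanSpace ℝ (Fin 3)))
    (h1 : ∀ x ∈ C, ‖x‖ = 1) (hC : 15 < C.card) (θ : ℝ)
    (hθ : ∀ x ∈ C, ∀ y ∈ C, x ≠ y → θ ≤ InnerProductGeometry.angle x y) :
    θ < Real.arccos (374 / 625) :=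
  minAngle_lt_arccos_of_codeBound ThreePointCert.T16d11.tammes16_card_le_15_sdp
    (by norm_num) C h1 hC θ hθ

/-- **Kernel bracket for the 16-point Tammes problem** (both sides in the tree): there ARE 16 unit vectors of
`ℝ³` with all pairwise inner products `≤ 61229468/10⁸` (`Config.Tammes.exists_code_16`, the best
configuration known, angle `52.2444…°`), and among ANY 16 unit vectors two distinct ones have inner product
`> 374/625` (angle `< 53.244…°`). In Tammes terms: `52.2444…° ≤ θ(16) < 53.2447°` (printed SDP bound
`53.27°`, BV 2007 T5.3). -/
theorem tammes16_bracket :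
    (∃ C : Finset (EuclideanSpace ℝ (Fin 3)), C.card = 16 ∧ (∀ x ∈ C, ‖x‖ = 1) ∧
      ∀ x ∈ C, ∀ y ∈ C, x ≠ y → inner ℝ x y ≤ (61229468 : ℝ) / 100000000) ∧
    ∀ C : Finset (EuclideanSpace ℝ (Fin 3)), (∀ x ∈ C, ‖x‖ = 1) → 15 < C.card →
      ∃ x ∈ C, ∃ y ∈ C, x ≠ y ∧ (374 / 625 : ℝ) < inner ℝ x y :=
  ⟨Config.Tammes.exists_code_16, fun C h1 hC => tammes16_exists_inner_gt C h1 hC⟩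

end Summit.Ventures.PackingBounds.SphericalCodes

end
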